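import Summits.Ventures.CertifiedArithmetic.LowPrec.GemmThetaLawGenStep

/-!
# Letter-dependent symbolic θ-certificates: soundness of the class check

HONEST FRAMING (venture CertifiedArithmetic / cell `pub-lowprec`, seat gemm, gen 12 → 13): certified
error envelopes and provably optimal rounding/accumulation schemes for low-precision formats under
stated cost models; every table by two implementations; no hardware or vendor claims.

Step (S3, second part) of the soundness chain for `GemmThetaLawGenDefs.lean` (cell HANDOFF decision
35; `code/gemm/thetalaw/GENDEFS-CONTRACT.md` §4): `clsOK_sound` — if `LawData.clsOK c = true` then
at every parameter `(K, T)` of the class domain (`M = M₀K = 2H = 2^m`, `K` even, law `contOK`),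
for the member state `V = sgn·v(K,T)` (a genuine state of the class's level: `t = gT + π` in the
level's range) and the letter `x = c.q`, the rounded result `R = rneZ m (V + x)` is a state and the
certificate inequalities hold in grid units: `0 ≤ d` (`d = |x| - γ`, `γ = R - V - x`); absorbed
with `x < 0` ⇒ `(-x)·(th0 + th1·M) ≤ thD·ψ(V)`; not absorbed ⇒ `ψ(R) ≤ ψ(V) + d`, `d > 0 ⇒ γ·ρD ≤
ρN·d`, `d = 0 ⇒ γ·(S_kb + B_kb·M) ≤ 2^kb·ψ(V)` together with the successor data `pmq` (even
trailing significand, `γ ≤ 2^{levExp}`, `pairOK`) whose reading is S3's last part.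
TECHNIQUE: `clsOK` is re-expressed through named pieces (`psiVq`, `psiWq`, `pmq`, `tailq`,
`clsOKq`; `clsOK_eq` is `rfl`), each read by its own lemma; the symbolic step is the rounded step
by `target_rneZ`, the two potentials by `psiVq_sound` / `psiWq_sound`.
-/

namespace Literature.ComputerArithmetic.FloatingPoint

namespace MiniFloat

namespace ThetaLaw

namespace LawData

variable (L : LawData)

open AForm

/-- The ψ-form of the source state, as chosen by `clsOK`. [cell] -/
def psiVq (c : GCls) : Option AForm :=
  let d := c.dom
  let v := L.vform c.lev c.g c.pi
  if c.sgn = 1 then (match c.lev with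
    | Lev.Q => some v
    | _ => L.psiLevel c.lev ⟨c.pi, 0, c.g⟩ d)
  else some v

/-- The ψ-form of the result, as chosen by `clsOK`. [cell] -/
def psiWq (c : GCls) (tg : TgtI) : Option AForm :=
  if tg.neg then some tg.tf else if c.sgn = 1 then L.psiLevel tg.lev tg.tf c.dom else some tg.W

/-- The successor data of a free move, as checked by `clsOK`: result not on `Q`, even trailing
significand, `δ ≤ 2^{levExp}`, and the pair table. [cell] -/
def pmq (c : GCls) (tg : TgtI) (delta : ℤ) : Bool :=
  match tg.lev with
  | Lev.Q => false
  | _ =>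
    decide (tg.tf.a % 2 = 0 ∧ tg.tf.c % 2 = 0) &&
      decide (delta ≤ 2 ^ L.levExp tg.lev) && L.pairOK tg.lev c.sgn

/-- The inequality part of `clsOK`, over given ψ-forms and gain `delta`. [cell] -/
def tailq (c : GCls) (tg : TgtI) (psiV psiW : AForm) (delta : ℤ) : Bool :=
  let d := c.dom
  L.closureOK d tg &&
    (if delta = -c.q then
      (if c.q < 0 then nonnegOnI d ((smul L.thD psiV).sub (smul (-c.q) L.thF)) else true)
    else
      let dd := |c.q| - delta
      nonnegOnI d ((psiV.add (const dd)).sub psiW) &&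
        (if dd < 0 then false
         else if 0 < dd then decide (delta * L.rhoD ≤ L.rhoN * dd)
         else
           nonnegOnI d ((smul (2 ^ L.kb) psiV).sub (smul delta L.kapF)) && L.pmq c tg delta))

/-- `clsOK`, re-expressed through the named pieces. [cell] -/
def clsOKq (c : GCls) : Bool :=
  let d := c.dom
  let v := L.vform c.lev c.g c.pi
  let n1 := v.add (const (c.sgn * c.q))
  match L.target d n1 c.tc with
  | none => false
  | some tg =>
      let dl := tg.W.sub n1
      if dl.b ≠ 0 ∨ dl.c ≠ 0 then false
      else
        match L.psiVq c, L.psiWq c tg with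
        | some psiV, some psiW => L.tailq c tg psiV psiW (dl.a * c.sgn)
        | _, _ => false

/-- The re-expression is definitionally the original. [cell] -/
theorem clsOK_eq (c : GCls) : L.clsOK c = L.clsOKq c := rfl

/-- DESTRUCTURING `clsOK`. [cell] -/
theorem clsOK_dest {c : GCls} (h : L.clsOK c = true) :
    ∃ tg : TgtI, ∃ psiV psiW : AForm,
      L.target c.dom ((L.vform c.lev c.g c.pi).add (const (c.sgn * c.q))) c.tc = some tg ∧
      (tg.W.sub ((L.vform c.lev c.g c.pi).add (const (c.sgn * c.q)))).b = 0 ∧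
      (tg.W.sub ((L.vform c.lev c.g c.pi).add (const (c.sgn * c.q)))).c = 0 ∧
      L.psiVq c = some psiV ∧ L.psiWq c tg = some psiW ∧
      L.tailq c tg psiV psiW
        ((tg.W.sub ((L.vform c.lev c.g c.pi).add (const (c.sgn * c.q)))).a * c.sgn) = true := by
  rw [clsOK_eq] at h
  unfold clsOKq at h
  simp only at h
  cases htg : L.target c.dom ((L.vform c.lev c.g c.pi).add (const (c.sgn * c.q))) c.tc with
  | none => rw [htg] at h; simp at h
  | some tg =>
    rw [htg] at h
    simp only at h
    by_cases hdl : (tg.W.sub ((L.vform c.lev c.g c.pi).add (const (c.sgn * c.q)))).b ≠ 0 ∨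
        (tg.W.sub ((L.vform c.lev c.g c.pi).add (const (c.sgn * c.q)))).c ≠ 0
    · rw [if_pos hdl] at h; simp at h
    rw [if_neg hdl] at h
    simp only [not_or, not_not] at hdl
    cases hpv : L.psiVq c with
    | none => rw [hpv] at h; simp at h
    | some psiV =>
      cases hpw : L.psiWq c tg with
      | none => rw [hpv, hpw] at h; simp at h
      | some psiW =>
        rw [hpv, hpw] at h
        simp only at h
        exact ⟨tg, psiV, psiW, rfl, hdl.1, hdl.2, rfl, hpw, h⟩

/-- READING THE INEQUALITY PART. [cell] -/
theorem tailq_sound {c : GCls} {K T : ℤ} (hd : c.dom.mem K T) {tg : TgtI} {psiV psiW : AForm}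
    {delta : ℤ} (h : L.tailq c tg psiV psiW delta = true) :
    L.closureOK c.dom tg = true ∧ 0 ≤ |c.q| - delta ∧
    (delta = -c.q → c.q < 0 → (-c.q) * L.thF.eval K T ≤ L.thD * psiV.eval K T) ∧
    (delta ≠ -c.q → psiW.eval K T ≤ psiV.eval K T + (|c.q| - delta)) ∧
    (delta ≠ -c.q → 0 < |c.q| - delta → delta * L.rhoD ≤ L.rhoN * (|c.q| - delta)) ∧
    (delta ≠ -c.q → |c.q| - delta = 0 →
      delta * L.kapF.eval K T ≤ 2 ^ L.kb * psiV.eval K T ∧ L.pmq c tg delta = true) := by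
  unfold tailq at h
  simp only [Bool.and_eq_true] at h
  obtain ⟨hcl, h⟩ := h
  by_cases habs : delta = -c.q
  · rw [if_pos habs] at h
    have hqq : 0 ≤ |c.q| - delta := by
      rw [habs]; have := neg_abs_le c.q; linarith
    refine ⟨hcl, hqq, fun _ hq => ?_, fun hne => absurd habs hne, fun hne => absurd habs hne,
      fun hne => absurd habs hne⟩
    rw [if_pos hq] at h
    have := nonnegOnI_sound h hd
    simp only [eval_sub, eval_smul] at this
    linarith
  · rw [if_neg habs] at h
    simp only [Bool.and_eq_true] at h
    obtain ⟨hpot, h⟩ := h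
    have hpot' := nonnegOnI_sound hpot hd
    simp only [eval_sub, eval_add, eval_const] at hpot'
    by_cases hneg : |c.q| - delta < 0
    · rw [if_pos hneg] at h; simp at h
    rw [if_neg hneg] at h
    refine ⟨hcl, by linarith, fun he => absurd he habs, fun _ => by linarith, fun _ hpos => ?_,
      fun _ hzero => ?_⟩
    · rw [if_pos hpos] at h
      exact of_decide_eq_true h
    · rw [if_neg (by omega)] at h
      simp only [Bool.and_eq_true] at h
      obtain ⟨hk, hpm⟩ := h
      have := nonnegOnI_sound hk hd
      simp only [eval_sub, eval_smul] at this
      exact ⟨by linarith, hpm⟩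

/-- Semantics of the magnitude form on `Q`. [cell] -/
theorem vform_eval_Q (g pi : ℕ) (K T : ℤ) :
    (L.vform Lev.Q g pi).eval K T = (g : ℤ) * T + pi := by
  simp only [vform, eval]; ring

/-- Semantics of the magnitude form on a binade. [cell] -/
theorem vform_eval_bin (j g pi : ℕ) (K T : ℤ) :
    (L.vform (Lev.bin j) g pi).eval K T = (L.M0 * K + ((g : ℤ) * T + pi)) * 2 ^ (j + 1) := by
  simp only [vform, eval, unit]; push_cast; ring

/-- Semantics of the magnitude form at the top. [cell] -/
theorem vform_eval_top (g pi : ℕ) (K T : ℤ) :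
    (L.vform Lev.top g pi).eval K T = (L.M0 * K + ((g : ℤ) * T + pi)) * 2 ^ (L.J + 2) := by
  simp only [vform, eval, unit]; push_cast; ring

/-- READING THE SOURCE POTENTIAL: for a genuine state of the class's level (`t = gT + π` in the
level's range) the chosen ψ-form evaluates to `psiZ` of the signed state. [cell] -/
theorem psiVq_sound (hc : L.contOK = true) {m : ℕ} {H K T : ℤ} (hM2 : (2 : ℤ) ^ m = 2 * H)
    (hMK : L.M0 * K = 2 * H) {c : GCls} (hd : c.dom.mem K T) (hs : c.sgn = 1 ∨ c.sgn = -1)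
    (hlev : ∀ j, c.lev = Lev.bin j → j ≤ L.J) (ht0 : 0 ≤ (c.g : ℤ) * T + c.pi)
    (hthi : (c.g : ℤ) * T + c.pi ≤ (L.trange c.lev).2.eval K 0)
    (htop : c.lev = Lev.top → (c.g : ℤ) * T + c.pi = 0) {psiV : AForm}
    (hpv : L.psiVq c = some psiV) :
    psiV.eval K T = L.psiZ m (c.sgn * (L.vform c.lev c.g c.pi).eval K T) := by
  have hH : 0 < H := by
    have : (0 : ℤ) < 2 ^ m := by positivity
    linarith
  have hv0 : 0 ≤ (L.vform c.lev c.g c.pi).eval K T := by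
    cases hl : c.lev with
    | Q => rw [L.vform_eval_Q]; exact ht0
    | bin j =>
      rw [L.vform_eval_bin, hMK]
      have : (0 : ℤ) < 2 ^ (j + 1) := by positivity
      nlinarith
    | top =>
      rw [L.vform_eval_top, hMK]
      have : (0 : ℤ) < 2 ^ (L.J + 2) := by positivity
      nlinarith
  unfold psiVq at hpv
  simp only at hpv
  rcases hs with hs | hs
  · rw [if_pos hs] at hpv
    rw [hs, one_mul]
    cases hl : c.lev with
    | Q =>
      rw [hl] at hpv hthi
      simp only [Option.some.injEq] at hpv
      subst hpv
      simp only [trange, eval] at hthi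
      rw [L.vform_eval_Q]
      have e2 : (2 : ℤ) * L.M0 * K = 2 * (L.M0 * K) := by ring
      exact (L.psiZ_of_small m ht0 (by rw [pow_succ, hM2]; linarith)).symm
    | bin j =>
      rw [hl] at hpv hthi
      simp only at hpv
      obtain ⟨-, -, hfe⟩ := L.psiLevel_bin_sound hc hM2 hMK hd (hlev j hl) hpv
      rw [hfe, L.vform_eval_bin, hMK]
      congr 1
      simp only [eval]
      ring
    | top =>
      rw [hl] at hpv hthi
      simp only at hpv
      obtain ⟨ht, hfe⟩ := L.psiLevel_top_sound hc hM2 hMK hd hpv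
      simp only [eval, zero_mul, add_zero] at ht
      rw [hfe, L.vform_eval_top, hMK]
      congr 1
      have := htop hl
      rw [show (c.g : ℤ) * T + c.pi = 0 by omega]
  · rw [if_neg (by rw [hs]; decide)] at hpv
    simp only [Option.some.injEq] at hpv
    subst hpv
    rw [hs, show (-1 : ℤ) * (L.vform c.lev c.g c.pi).eval K T = -((L.vform c.lev c.g c.pi).eval K T)
      by ring]
    exact (L.psiZ_neg_of_nonneg m hv0).symm

/-- READING THE RESULT POTENTIAL: the chosen ψ-form of the result evaluates to `psiZ` of the signed
result. [cell] -/
theorem psiWq_sound (hc : L.contOK = true) {m : ℕ} {H K T : ℤ} (hM2 : (2 : ℤ) ^ m = 2 * H)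
    (hMK : L.M0 * K = 2 * H) {c : GCls} (hd : c.dom.mem K T) (hev : 2 ∣ K)
    (hs : c.sgn = 1 ∨ c.sgn = -1) {n : AForm} {tg : TgtI} (htg : L.target c.dom n c.tc = some tg)
    (hcl : L.closureOK c.dom tg = true) {psiW : AForm} (hpw : L.psiWq c tg = some psiW) :
    psiW.eval K T = L.psiZ m (c.sgn * tg.W.eval K T) := by
  have hM : (2 : ℤ) ^ m = L.M0 * K := by rw [hM2, hMK]
  unfold psiWq at hpw
  cases hng : tg.neg with
  | true =>
    rw [hng, if_pos rfl] at hpw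
    simp only [Option.some.injEq] at hpw
    subst hpw
    cases htc : c.tc with
    | xpos =>
      rw [htc] at htg
      obtain ⟨rfl, -, -⟩ := L.target_xpos_sound hd htg
      simp at hng
    | bin e =>
      rw [htc] at htg
      obtain ⟨sig, rfl, -⟩ := L.target_bin_sound hd hev hM htg
      simp at hng
    | xneg =>
      rw [htc] at htg
      exact (L.target_psi_flip hd hM htg hs).symm
  | false =>
    rw [hng] at hpw
    simp only [Bool.false_eq_true, if_false] at hpw
    rcases hs with hs | hs
    · rw [if_pos hs] at hpw
      rw [hs, one_mul]
      exact L.target_psi_pos hc hM2 hMK hd hev htg hcl hng hpw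
    · rw [if_neg (by rw [hs]; decide)] at hpw
      simp only [Option.some.injEq] at hpw
      subst hpw
      rw [hs, show (-1 : ℤ) * tg.W.eval K T = -(tg.W.eval K T) by ring]
      exact (L.target_psi_negframe hd hev hM htg hng).symm

/-- SOUNDNESS OF THE CLASS CHECK (grid units; see the module docstring). [cell] -/
theorem clsOK_sound (hc : L.contOK = true) {m : ℕ} {H K T : ℤ} (hM2 : (2 : ℤ) ^ m = 2 * H)
    (hMK : L.M0 * K = 2 * H) (hev : 2 ∣ K) {c : GCls} (h : L.clsOK c = true)
    (hd : c.dom.mem K T) (hs : c.sgn = 1 ∨ c.sgn = -1)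
    (hlev : ∀ j, c.lev = Lev.bin j → j ≤ L.J) (ht0 : 0 ≤ (c.g : ℤ) * T + c.pi)
    (hthi : (c.g : ℤ) * T + c.pi ≤ (L.trange c.lev).2.eval K 0)
    (htop : c.lev = Lev.top → (c.g : ℤ) * T + c.pi = 0) {V R : ℤ}
    (hV : V = c.sgn * (L.vform c.lev c.g c.pi).eval K T) (hR : R = rneZ m (V + c.q)) :
    L.stZ m R ∧ 0 ≤ |c.q| - (R - V - c.q) ∧
    (R = V → c.q < 0 → (-c.q) * L.thF.eval K T ≤ L.thD * L.psiZ m V) ∧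
    (R ≠ V → L.psiZ m R ≤ L.psiZ m V + (|c.q| - (R - V - c.q))) ∧
    (R ≠ V → 0 < |c.q| - (R - V - c.q) →
      (R - V - c.q) * L.rhoD ≤ L.rhoN * (|c.q| - (R - V - c.q))) ∧
    (R ≠ V → |c.q| - (R - V - c.q) = 0 →
      (R - V - c.q) * L.kapF.eval K T ≤ 2 ^ L.kb * L.psiZ m V ∧
      ∃ tg : TgtI, L.target c.dom ((L.vform c.lev c.g c.pi).add (const (c.sgn * c.q))) c.tc =
          some tg ∧ L.closureOK c.dom tg = true ∧ R = c.sgn * tg.W.eval K T ∧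
        L.pmq c tg (R - V - c.q) = true) := by
  have hM : (2 : ℤ) ^ m = L.M0 * K := by rw [hM2, hMK]
  obtain ⟨tg, psiV, psiW, htg, hb, hcf, hpv, hpw, htail⟩ := L.clsOK_dest h
  have hs2 : c.sgn * c.sgn = 1 := by rcases hs with h1 | h1 <;> rw [h1] <;> norm_num
  -- the symbolic step is the rounded step, and its gain is the constant `dl.a` (in the frame)
  have hW := L.target_rneZ hd hev hM htg
  have hn1 : ((L.vform c.lev c.g c.pi).add (const (c.sgn * c.q))).eval K T =
      (L.vform c.lev c.g c.pi).eval K T + c.sgn * c.q := by simp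
  have hdl : tg.W.eval K T = (L.vform c.lev c.g c.pi).eval K T + c.sgn * c.q +
      (tg.W.sub ((L.vform c.lev c.g c.pi).add (const (c.sgn * c.q)))).a := by
    have e : (tg.W.sub ((L.vform c.lev c.g c.pi).add (const (c.sgn * c.q)))).eval K T =
        (tg.W.sub ((L.vform c.lev c.g c.pi).add (const (c.sgn * c.q)))).a := by
      rw [show ∀ f : AForm, f.eval K T = f.a + f.b * K + f.c * T from fun f => rfl, hb, hcf]
      ring
    rw [eval_sub, hn1] at e
    linarith
  have hRW : R = c.sgn * tg.W.eval K T := by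
    rw [hR, hV, ← hW, hn1]
    rcases hs with h1 | h1
    · rw [h1]; simp
    · rw [h1, show (-1 : ℤ) * (L.vform c.lev c.g c.pi).eval K T + c.q =
          -((L.vform c.lev c.g c.pi).eval K T + -1 * c.q) by ring, rneZ_neg]
      ring
  have hγ : R - V - c.q =
      (tg.W.sub ((L.vform c.lev c.g c.pi).add (const (c.sgn * c.q)))).a * c.sgn := by
    rw [hRW, hV]
    linear_combination c.sgn * hdl + c.q * hs2
  obtain ⟨hcl, hdd, hF1, hF2, hF4, hF5⟩ := L.tailq_sound hd htail
  have hψV := L.psiVq_sound hc hM2 hMK hd hs hlev ht0 hthi htop hpv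
  have hψW := L.psiWq_sound hc hM2 hMK hd hev hs htg hcl hpw
  rw [← hV] at hψV
  rw [← hRW] at hψW
  refine ⟨?_, by rw [hγ]; exact hdd, fun hRV hq => ?_, fun hne => ?_, fun hne hpos => ?_,
    fun hne hz => ?_⟩
  · have hst := L.target_stZ hd hev hM htg hcl
    rw [hRW]
    rcases hs with h1 | h1
    · rw [h1, one_mul]; exact hst
    · rw [h1, neg_one_mul]
      unfold stZ at hst ⊢
      rw [Int.natAbs_neg]
      exact hst
  · have := hF1 (by rw [← hγ]; omega) hq
    rw [hψV] at this
    exact this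
  · have := hF2 (by rw [← hγ]; omega)
    rw [hψV, hψW, ← hγ] at this
    exact this
  · rw [hγ] at hpos ⊢
    exact hF4 (by rw [← hγ]; omega) hpos
  · have hne' : (tg.W.sub ((L.vform c.lev c.g c.pi).add (const (c.sgn * c.q)))).a * c.sgn ≠
        -c.q := by rw [← hγ]; omega
    obtain ⟨hk, hpm⟩ := hF5 hne' (by rw [← hγ]; exact hz)
    refine ⟨?_, tg, htg, hcl, hRW, by rw [hγ]; exact hpm⟩
    rw [hγ, ← hψV]
    exact hk

end LawData

end ThetaLaw

end MiniFloat

end Literature.ComputerArithmetic.FloatingPoint
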